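/-
Copyright: the m5 harness (cell B2b-5 `b2b-lgcu-borel`, generation 22).  Sorry-free; axioms: propext,
Classical.choice, Quot.sound.  VALUE = THEOREM (a budget-free, TPP-free configuration exclusion on the
level-one slice), NOT summit progress: the crux `SubgroupIdentityDesigns`
(stmt-MatrixMultiplication-14079) is untouched and remains open.
-/
import Mathlib
import Summits.MatrixMultiplication.MatrixMultiplication.Theorems.SubgroupIdentityDesigns.Negative.SquareReflections

/-!
# No member contains all reflections of `𝔽_p^m` — every odd `p`, every `m ≥ 3`

Route `LevelGradedCohnUmans`, crux `SubgroupIdentityDesigns`, level-one slice.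

The uniform statement behind `NonsquareReflections`, `NonsquareReflectionsFour` and
`SquareReflections`: for EVERY odd prime `p`, EVERY `m ≥ 3` and EVERY `ε`, no member `H_i` of a
triple `(H₁,H₂,H₃) ≤ GL_m(𝔽_p)³` carrying a level-one identity design contains all orthogonal
reflections `R_b = 1 − (2/(b ⬝ b)) b bᵀ` (`b ⬝ b ≠ 0`) of the form `x₁² + ⋯ + x_m²`; in particular no
member contains the orthogonal group `O_m(𝔽_p)` of that form, in any coordinates reachable by
`SummandTransport`.  Proof: for `m ≥ 4` either square class alone suffices (every odd `p`); for `m = 3`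
use the square class if `−1` is a square and the non-square class otherwise — in each case the
reflections of that class fix-cover `𝔽_p^m ∖ 0` by determinant-`(−1)` elements, which contradicts
`GLmLevelOneCertificates.no_levelOne_design_of_detFixers_gl`.  No TPP, no budget inequality.
By simultaneous conjugation (`DesignConjGL.no_design_of_conj_le`) the same holds for the reflections
of every quadratic form `GL_m(𝔽_p)`-equivalent to a scalar multiple of `x₁² + ⋯ + x_m²` — in
dimension `3`, of EVERY non-degenerate ternary form (`Q ≅ c·(x² + y² + z²)`, and `O(cQ) = O(Q)`).

HONEST SCOPE.  A configuration exclusion; no `(p,m,ε)` cell is emptied.  What a SINGLE class of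
reflections cannot decide is recorded in `SquareReflections` (dimension `3`, the class of sign
`−χ(−1)`).
-/

set_option linter.dupNamespace false

noncomputable section

open scoped BigOperators Classical Matrix

namespace Summit.MatrixMultiplication.MatrixMultiplication.Theorems.SubgroupIdentityDesigns.Negative
namespace NonsquareReflections

open Summit.MatrixMultiplication.MatrixMultiplication.Theorems.LieRankDesigns.Negative (GLm Mat)

variable {p : ℕ} [hp : Fact p.Prime] {m : ℕ}

/-- **NO MEMBER CONTAINS ALL REFLECTIONS OF `𝔽_p^m`** (every odd `p`, every `m ≥ 3`, every `ε`,
no TPP): member `1`. -/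
theorem no_design_mem₁_of_reflections (hp2 : p ≠ 2) (hm : 3 ≤ m)
    {H₁ H₂ H₃ : Subgroup (GLm p m)} (h₁ : ∀ b : Fin m → ZMod p, b ⬝ᵥ b ≠ 0 → refl b ∈ H₁) :
    ¬ ∃ c : Mat p m → ℂ, (∀ M, 1 < M.rank → c M = 0) ∧
      (∑ M, c M * ZMod.stdAddChar (Matrix.trace (M * ((1 : GLm p m) : Mat p m)))) = 1 ∧
      ∀ a ∈ H₁, ∀ b ∈ H₂, ∀ g ∈ H₃, a * b * g ≠ 1 →
        (∑ M, c M * ZMod.stdAddChar (Matrix.trace (M * ((a * b * g : GLm p m) : Mat p m)))) = 0 := by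
  by_cases hm1 : IsSquare (-1 : ZMod p)
  · exact no_design_sq_mem₁_of_three_le hm1 hp2 hm fun b hb0 _ => h₁ b hb0
  · exact no_design_mem₁_of_three_le hm1 hm fun b hb => h₁ b fun h0 => hb (h0 ▸ IsSquare.zero)

/-- Member `2`. -/
theorem no_design_mem₂_of_reflections (hp2 : p ≠ 2) (hm : 3 ≤ m)
    {H₁ H₂ H₃ : Subgroup (GLm p m)} (h₂ : ∀ b : Fin m → ZMod p, b ⬝ᵥ b ≠ 0 → refl b ∈ H₂) :
    ¬ ∃ c : Mat p m → ℂ, (∀ M, 1 < M.rank → c M = 0) ∧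
      (∑ M, c M * ZMod.stdAddChar (Matrix.trace (M * ((1 : GLm p m) : Mat p m)))) = 1 ∧
      ∀ a ∈ H₁, ∀ b ∈ H₂, ∀ g ∈ H₃, a * b * g ≠ 1 →
        (∑ M, c M * ZMod.stdAddChar (Matrix.trace (M * ((a * b * g : GLm p m) : Mat p m)))) = 0 := by
  by_cases hm1 : IsSquare (-1 : ZMod p)
  · exact no_design_sq_mem₂_of_three_le hm1 hp2 hm fun b hb0 _ => h₂ b hb0
  · exact no_design_mem₂_of_three_le hm1 hm fun b hb => h₂ b fun h0 => hb (h0 ▸ IsSquare.zero)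

/-- Member `3`. -/
theorem no_design_mem₃_of_reflections (hp2 : p ≠ 2) (hm : 3 ≤ m)
    {H₁ H₂ H₃ : Subgroup (GLm p m)} (h₃ : ∀ b : Fin m → ZMod p, b ⬝ᵥ b ≠ 0 → refl b ∈ H₃) :
    ¬ ∃ c : Mat p m → ℂ, (∀ M, 1 < M.rank → c M = 0) ∧
      (∑ M, c M * ZMod.stdAddChar (Matrix.trace (M * ((1 : GLm p m) : Mat p m)))) = 1 ∧
      ∀ a ∈ H₁, ∀ b ∈ H₂, ∀ g ∈ H₃, a * b * g ≠ 1 →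
        (∑ M, c M * ZMod.stdAddChar (Matrix.trace (M * ((a * b * g : GLm p m) : Mat p m)))) = 0 := by
  by_cases hm1 : IsSquare (-1 : ZMod p)
  · exact no_design_sq_mem₃_of_three_le hm1 hp2 hm fun b hb0 _ => h₃ b hb0
  · exact no_design_mem₃_of_three_le hm1 hm fun b hb => h₃ b fun h0 => hb (h0 ▸ IsSquare.zero)

end NonsquareReflections
end Summit.MatrixMultiplication.MatrixMultiplication.Theorems.SubgroupIdentityDesigns.Negative

end
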